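import Mathlib
import HarnessLib
import Summits.NavierStokesRegularity.NavierStokesRegularity.Theorems.UnthreadedDoorCellFluxClassOscTransport
import Summits.NavierStokesRegularity.NavierStokesRegularity.Theorems.UnthreadedDoorCellFluxNearCriticalBound
import Summits.NavierStokesRegularity.NavierStokesRegularity.Theorems.UnthreadedDoorCellFluxLipschitzSelection

/-!
# Route `UnthreadedDoor`, crux `PoloidalLiouville` (stmt-NavierStokesRegularity-1222), WALL W1 — crux idea «cell-flux», support toward
# Σ-0bR₂ `ClusterFluxNearCentreLipschitz`: the MATCHED STEP (bookkeeping layer of the envelope principle)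

Assembly of the landed per-class estimates into the two comparison inequalities a proof of Σ-0bR₂ (or of its tame twin Σ-0bR₂ᵗ, custodian
ns-idea-14 g13, CellFluxSketch v1.2.18) iterates between re-grouping events.  Classes are indexed by a `Finset ι` and MATCHED index by index
(the geometric input (G) of the roadmap supplies the matching, the sliver width `ρ` and the criticality defect `ε`; nothing about cells, rules or
admissibility is used here):

* ★ `abs_radial_step_le` — RADIAL matched step at one time: classes at radius `r` are `x₀ + r·A i` (`A i ⊆ S²` direction sets), classes at radius
  `r'` are `K' i ⊆ S_{r'}(x₀)`, and `K' i` differs from the transported class `x₀ + r'·A i` only within `ρ` of `ε`-critical points of each other's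
  closure.  Then
  `|r' Σ_i osc_{K' i} T − r Σ_i osc_{x₀ + r A i} T| ≤ #ι · (πL r' |r' − r| + r (πL|r' − r| + π ε ρ / r' + π² L ρ² /(2 r')))`
  (growth `setOsc_le_of_subset_sphere`, transport p733827, sliver p734524);
* ★ `abs_temporal_step_le` — TEMPORAL matched step at one radius `a`: two slices `T, T'` with fields `v, v'`, `‖curl v − curl v'‖ ≤ K` on
  `S_a(x₀)`, classes `K i` and `K' i ⊆ S_a(x₀)` differing only within `ρ` of `ε`-critical points (for `v'`) of each other's closure.  Then
  `|a Σ_i osc_{K' i} T' − a Σ_i osc_{K i} T| ≤ a · #ι · (π K + π ε ρ / a + π² L' ρ² /(2 a))`;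
* `lipschitzOnWith_of_local_two_point` — LOCAL-TO-GLOBAL glue: on an order-connected `J ⊆ ℝ`, a function obeying the two-point bound
  `|f z − f y| ≤ K |z − y|` for `y, z ∈ J` near each point of `J` is `K`-Lipschitz on `J` (compactness of `[x,y]` + the chain lemma p733168) — this
  turns the matched steps (valid for `|Δ|` small) into the Lipschitz bound on every event-free interval;
* `clusterFlux_eq_mul_finset_sum` — bridge from `clusterFlux` (a `finsum` over a finite family of classes) to an indexed `Finset` sum;
  `setOsc_le_of_subset_sphere` (growth `≤ πLρ` for any nonempty subset of `S_ρ`), `setOsc_nonneg_of_bdd` / `_of_subset_sphere`.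

With `ε = L|Δr|`, `ρ² ≤ H r'|Δr|` (resp. `ε = M a |Δt|`, `K = M a |Δt|`, `ρ² ≤ H a² |Δt|`) and `#ι ≤ N₀` both right-hand sides are
`O(a₀)|Δr|` resp. `O(a²)|Δt|` — the constants of Σ-0bR₂.  What remains OPEN: the existence of such matchings for an admissible rule of analytic data
off a locally finite event set (roadmap (G), HOME `NOTE-Sigma0bR2-roadmap-qj-p1-g9.md`), then p733168 glues across events.

HONEST LABEL: support lemmas strictly below W1; Σ-0bR₂, the cell-flux chain, `PoloidalLiouville` ⟨1222⟩, W1 and NS regularity are OPEN — NOT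
proved.  `--supports stmt-NavierStokesRegularity-1222 --as helper`.  [folklore]
-/

noncomputable section

-- the summit and its single sub-problem share the name (CONVENTIONS §1)
set_option linter.dupNamespace false

open Set Function Filter Topology InnerProductSpace MeasureTheory
open scoped RealInnerProductSpace ContDiff NNReal

namespace Summit.NavierStokesRegularity.NavierStokesRegularity.Theorems.PoloidalLiouville.CellFlux

open Summit.NavierStokesRegularity.NavierStokesRegularity.Theorems.PoloidalLiouville.NetFlux
  (E3 sphOsc ne_center_of_mem_sphere continuousOn_sphere_of_continuousOn_compl bddAbove_image_sphere sphOsc_le_of_fderiv_curl_le)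
open Literature.Analysis Literature.Analysis.FluidPDE

/-! ### Growth of the oscillation over a subset of a small sphere -/

/-- **Growth**: for a nonempty `B ⊆ S_ρ(x₀)`, `ρ ∈ (0,1]`, `osc_B T ≤ π L ρ` (the sphere's oscillation bounds that of its subsets;
`NetFlux.sphOsc_le_of_fderiv_curl_le`). [folklore] -/
theorem setOsc_le_of_subset_sphere {v : E3 → E3} {T : E3 → ℝ} {x₀ : E3} {L ρ : ℝ} (hv : ContDiff ℝ 2 v)
    (hT : ContDiffOn ℝ 1 T ({x₀}ᶜ)) (hrep : ∀ x, curl v x = cross (gradient T x) (x - x₀))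
    (hL : ∀ x ∈ Metric.closedBall x₀ 1, ‖fderiv ℝ (curl v) x‖ ≤ L) (hρ : 0 < ρ) (hρ1 : ρ ≤ 1)
    {B : Set E3} (hB : B ⊆ Metric.sphere x₀ ρ) (hne : B.Nonempty) :
    setOsc T B ≤ Real.pi * L * ρ := by
  have hLρ : ∀ x ∈ Metric.closedBall x₀ ρ, ‖fderiv ℝ (curl v) x‖ ≤ L :=
    fun x hx => hL x (Metric.closedBall_subset_closedBall hρ1 hx)
  have h1 := sphOsc_le_of_fderiv_curl_le v x₀ T hρ hv hT hrep hLρ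
  have hc := continuousOn_sphere_of_continuousOn_compl hT.continuousOn hρ
  have h2 := setOsc_mono hB hne (bddAbove_image_sphere hc) ((isCompact_sphere x₀ ρ).bddBelow_image hc)
  exact h2.trans h1

/-- The oscillation over a nonempty set with bounded image is nonnegative. [folklore] -/
theorem setOsc_nonneg_of_bdd {T : E3 → ℝ} {B : Set E3} (hne : B.Nonempty) (ha : BddAbove (T '' B)) (hb : BddBelow (T '' B)) :
    0 ≤ setOsc T B := by
  obtain ⟨x, hx⟩ := hne
  have h1 := le_csSup ha (mem_image_of_mem T hx)
  have h2 := csInf_le hb (mem_image_of_mem T hx)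
  rw [setOsc]
  linarith

/-- The oscillation over a nonempty subset of a sphere (for `T` continuous off the centre, `ρ > 0`) is nonnegative. [folklore] -/
theorem setOsc_nonneg_of_subset_sphere {T : E3 → ℝ} {x₀ : E3} {ρ : ℝ} (hT : ContinuousOn T ({x₀}ᶜ)) (hρ : 0 < ρ)
    {B : Set E3} (hB : B ⊆ Metric.sphere x₀ ρ) (hne : B.Nonempty) : 0 ≤ setOsc T B := by
  have hc := continuousOn_sphere_of_continuousOn_compl hT hρ
  exact setOsc_nonneg_of_bdd hne ((bddAbove_image_sphere hc).mono (image_mono hB))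
    (((isCompact_sphere x₀ ρ).bddBelow_image hc).mono (image_mono hB))

/-! ### Finite sums: elementary bookkeeping -/

/-- **Bridge**: the cluster flux of a finite family of classes, enumerated injectively by a `Finset`, is `r` times the indexed sum of the class
oscillations. [folklore] -/
theorem clusterFlux_eq_mul_finset_sum {ι : Type*} (T : E3 → ℝ) (r : ℝ) (s : Finset ι) (K : ι → Set E3) (hinj : Set.InjOn K s) :
    clusterFlux T r (K '' s) = r * ∑ i ∈ s, setOsc T (K i) := by
  rw [clusterFlux, finsum_mem_image hinj, finsum_mem_coe_finset]

/-! ### The radial matched step -/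

/-- ★ **Radial matched step** (one time, two radii `r, r' ∈ (0,1]`).  For `v ∈ C²`, `T ∈ C¹` off `x₀`, `curl v = ∇T × (x − x₀)`,
`‖D curl v‖ ≤ L` on `B̄(x₀,1)`; classes at radius `r` given by nonempty direction sets `A i ⊆ S²` (`i ∈ s`), classes `K' i ⊆ S_{r'}(x₀)` at
radius `r'`, such that `K' i` and the transported class `x₀ + r'·A i` differ only within `ρ` of `ε`-critical points of each other's closure
(`0 ≤ ε`, `0 ≤ ρ`).  Then
`|r' Σ osc_{K' i} T − r Σ osc_{x₀ + r·A i} T| ≤ #s · (π L r' |r' − r| + r (π L |r' − r| + π ε ρ / r' + π² L ρ² / (2 r')))`. [folklore] -/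
theorem abs_radial_step_le {ι : Type*} {v : E3 → E3} {T : E3 → ℝ} {x₀ : E3} {L r r' ε ρ : ℝ} (hv : ContDiff ℝ 2 v)
    (hT : ContDiffOn ℝ 1 T ({x₀}ᶜ)) (hrep : ∀ x, curl v x = cross (gradient T x) (x - x₀))
    (hL : ∀ x ∈ Metric.closedBall x₀ 1, ‖fderiv ℝ (curl v) x‖ ≤ L)
    (hr : 0 < r) (hr1 : r ≤ 1) (hr' : 0 < r') (hr'1 : r' ≤ 1) (hε : 0 ≤ ε) (hρ : 0 ≤ ρ)
    (s : Finset ι) (A K' : ι → Set E3)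
    (hA : ∀ i ∈ s, A i ⊆ Metric.sphere (0 : E3) 1 ∧ (A i).Nonempty)
    (hK' : ∀ i ∈ s, K' i ⊆ Metric.sphere x₀ r' ∧ (K' i).Nonempty)
    (hnear : ∀ i ∈ s, ∀ q ∈ K' i, q ∈ (fun ζ : E3 => x₀ + r' • ζ) '' A i ∨
      ∃ p ∈ closure ((fun ζ : E3 => x₀ + r' • ζ) '' A i), ‖curl v p‖ ≤ ε ∧ ‖q - p‖ ≤ ρ)
    (hnear' : ∀ i ∈ s, ∀ q ∈ (fun ζ : E3 => x₀ + r' • ζ) '' A i, q ∈ K' i ∨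
      ∃ p ∈ closure (K' i), ‖curl v p‖ ≤ ε ∧ ‖q - p‖ ≤ ρ) :
    |r' * ∑ i ∈ s, setOsc T (K' i) - r * ∑ i ∈ s, setOsc T ((fun ζ : E3 => x₀ + r • ζ) '' A i)|
      ≤ s.card * (Real.pi * L * r' * |r' - r| +
          r * (Real.pi * L * |r' - r| + Real.pi * ε * ρ / r' + Real.pi ^ 2 * L * ρ ^ 2 / (2 * r'))) := by
  have hL0 : 0 ≤ L := (norm_nonneg _).trans (hL x₀ (Metric.mem_closedBall_self zero_le_one))
  -- images of direction sets lie on the spheres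
  have himg : ∀ {σ : ℝ}, 0 < σ → ∀ i ∈ s, (fun ζ : E3 => x₀ + σ • ζ) '' A i ⊆ Metric.sphere x₀ σ := by
    intro σ hσ i hi
    rintro _ ⟨ζ, hζ, rfl⟩
    have hζ1 : ‖ζ‖ = 1 := by simpa using (hA i hi).1 hζ
    rw [mem_sphere_iff_norm, add_sub_cancel_left, norm_smul, Real.norm_of_nonneg hσ.le, hζ1, mul_one]
  set S' : ℝ := ∑ i ∈ s, setOsc T (K' i) with hS'
  set S : ℝ := ∑ i ∈ s, setOsc T ((fun ζ : E3 => x₀ + r • ζ) '' A i) with hS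
  -- (1) growth: `0 ≤ S' ≤ #s · π L r'`
  have hS'0 : 0 ≤ S' := Finset.sum_nonneg fun i hi =>
    setOsc_nonneg_of_subset_sphere hT.continuousOn hr' (hK' i hi).1 (hK' i hi).2
  have hS'le : S' ≤ s.card * (Real.pi * L * r') := by
    have h := Finset.sum_le_sum fun i hi => setOsc_le_of_subset_sphere hv hT hrep hL hr' hr'1 (hK' i hi).1 (hK' i hi).2
    rwa [Finset.sum_const, nsmul_eq_mul] at h
  -- (2) per-class: transport + sliver
  set B : ℝ := Real.pi * L * |r' - r| + Real.pi * ε * ρ / r' + Real.pi ^ 2 * L * ρ ^ 2 / (2 * r') with hB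
  have hterm : ∀ i ∈ s, |setOsc T (K' i) - setOsc T ((fun ζ : E3 => x₀ + r • ζ) '' A i)| ≤ B := by
    intro i hi
    obtain ⟨hAi, hAne⟩ := hA i hi
    obtain ⟨hK'i, hK'ne⟩ := hK' i hi
    -- transport `r → r'` of the direction set
    have ht := abs_setOsc_dirSlice_sub_le_radius hv hT hrep hL hr' hr'1 hr hr1 hAi hAne
    rw [← setOsc_image_dirSlice T x₀ r' (A i), ← setOsc_image_dirSlice T x₀ r (A i)] at ht
    -- sliver between the transported class and `K' i`
    have hsl := abs_setOsc_sub_setOsc_le_of_near_approxCrit hv hT hrep hL hr' hr'1 hρ hε (himg hr' i hi) hK'i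
      (hAne.image _) hK'ne (hnear i hi) (hnear' i hi)
    calc |setOsc T (K' i) - setOsc T ((fun ζ : E3 => x₀ + r • ζ) '' A i)|
        = |(setOsc T (K' i) - setOsc T ((fun ζ : E3 => x₀ + r' • ζ) '' A i)) +
            (setOsc T ((fun ζ : E3 => x₀ + r' • ζ) '' A i) - setOsc T ((fun ζ : E3 => x₀ + r • ζ) '' A i))| := by ring_nf
      _ ≤ |setOsc T (K' i) - setOsc T ((fun ζ : E3 => x₀ + r' • ζ) '' A i)| +
            |setOsc T ((fun ζ : E3 => x₀ + r' • ζ) '' A i) - setOsc T ((fun ζ : E3 => x₀ + r • ζ) '' A i)| := abs_add_le _ _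
      _ ≤ (Real.pi * ε * ρ / r' + Real.pi ^ 2 * L * ρ ^ 2 / (2 * r')) + Real.pi * L * |r' - r| := add_le_add hsl ht
      _ = B := by rw [hB]; ring
  have hdiff : |S' - S| ≤ s.card * B := by
    rw [hS', hS, ← Finset.sum_sub_distrib]
    calc |∑ i ∈ s, (setOsc T (K' i) - setOsc T ((fun ζ : E3 => x₀ + r • ζ) '' A i))|
        ≤ ∑ i ∈ s, |setOsc T (K' i) - setOsc T ((fun ζ : E3 => x₀ + r • ζ) '' A i)| := Finset.abs_sum_le_sum_abs _ _
      _ ≤ ∑ i ∈ s, B := Finset.sum_le_sum hterm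
      _ = s.card * B := by rw [Finset.sum_const, nsmul_eq_mul]
  -- (3) `r' S' − r S = (r' − r) S' + r (S' − S)`
  have hsplit : r' * S' - r * S = (r' - r) * S' + r * (S' - S) := by ring
  calc |r' * S' - r * S| = |(r' - r) * S' + r * (S' - S)| := by rw [hsplit]
    _ ≤ |(r' - r) * S'| + |r * (S' - S)| := abs_add_le _ _
    _ = |r' - r| * S' + r * |S' - S| := by rw [abs_mul, abs_mul, abs_of_nonneg hS'0, abs_of_nonneg hr.le]
    _ ≤ |r' - r| * (s.card * (Real.pi * L * r')) + r * (s.card * B) :=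
        add_le_add (mul_le_mul_of_nonneg_left hS'le (abs_nonneg _)) (mul_le_mul_of_nonneg_left hdiff hr.le)
    _ = s.card * (Real.pi * L * r' * |r' - r| + r * B) := by ring

/-! ### The temporal matched step -/

/-- ★ **Temporal matched step** (one radius `a ∈ (0,1]`, two slices).  For two toroidal representations `curl v = ∇T × (x − x₀)`,
`curl v' = ∇T' × (x − x₀)` (`v, v' ∈ C²`, `T, T' ∈ C¹` off `x₀`) with `‖curl v − curl v'‖ ≤ K` on `S_a(x₀)` and `‖D curl v'‖ ≤ L'` on
`B̄(x₀,1)`; classes `K i` (for `T`) and `K' i` (for `T'`), nonempty subsets of `S_a(x₀)`, such that `K' i` and `K i` differ only within `ρ` of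
`ε`-critical points (for `v'`) of each other's closure.  Then
`|a Σ osc_{K' i} T' − a Σ osc_{K i} T| ≤ a · #s · (π K + π ε ρ / a + π² L' ρ² / (2 a))`. [folklore] -/
theorem abs_temporal_step_le {ι : Type*} {v v' : E3 → E3} {T T' : E3 → ℝ} {x₀ : E3} {K L' a ε ρ : ℝ} (hv' : ContDiff ℝ 2 v')
    (hT : ContDiffOn ℝ 1 T ({x₀}ᶜ)) (hT' : ContDiffOn ℝ 1 T' ({x₀}ᶜ))
    (hrep : ∀ x, curl v x = cross (gradient T x) (x - x₀)) (hrep' : ∀ x, curl v' x = cross (gradient T' x) (x - x₀))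
    (hK : ∀ x ∈ Metric.sphere x₀ a, ‖curl v x - curl v' x‖ ≤ K)
    (hL' : ∀ x ∈ Metric.closedBall x₀ 1, ‖fderiv ℝ (curl v') x‖ ≤ L')
    (ha : 0 < a) (ha1 : a ≤ 1) (hε : 0 ≤ ε) (hρ : 0 ≤ ρ)
    (s : Finset ι) (Kc Kc' : ι → Set E3)
    (hKc : ∀ i ∈ s, Kc i ⊆ Metric.sphere x₀ a ∧ (Kc i).Nonempty)
    (hKc' : ∀ i ∈ s, Kc' i ⊆ Metric.sphere x₀ a ∧ (Kc' i).Nonempty)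
    (hnear : ∀ i ∈ s, ∀ q ∈ Kc' i, q ∈ Kc i ∨ ∃ p ∈ closure (Kc i), ‖curl v' p‖ ≤ ε ∧ ‖q - p‖ ≤ ρ)
    (hnear' : ∀ i ∈ s, ∀ q ∈ Kc i, q ∈ Kc' i ∨ ∃ p ∈ closure (Kc' i), ‖curl v' p‖ ≤ ε ∧ ‖q - p‖ ≤ ρ) :
    |a * ∑ i ∈ s, setOsc T' (Kc' i) - a * ∑ i ∈ s, setOsc T (Kc i)|
      ≤ a * (s.card * (Real.pi * K + Real.pi * ε * ρ / a + Real.pi ^ 2 * L' * ρ ^ 2 / (2 * a))) := by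
  set B : ℝ := Real.pi * K + Real.pi * ε * ρ / a + Real.pi ^ 2 * L' * ρ ^ 2 / (2 * a) with hB
  have hterm : ∀ i ∈ s, |setOsc T' (Kc' i) - setOsc T (Kc i)| ≤ B := by
    intro i hi
    obtain ⟨hKi, hKne⟩ := hKc i hi
    obtain ⟨hK'i, hK'ne⟩ := hKc' i hi
    -- sliver for the slice `T'` between `Kc i` and `Kc' i`
    have hsl := abs_setOsc_sub_setOsc_le_of_near_approxCrit hv' hT' hrep' hL' ha ha1 hρ hε hKi hK'i hKne hK'ne
      (hnear i hi) (hnear' i hi)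
    -- two fields on the frozen class `Kc i`
    have hft := abs_setOsc_sub_setOsc_le_of_norm_curl_sub_le' ha hT' hT hrep' hrep
      (fun x hx => by rw [norm_sub_rev]; exact hK x hx) hKi hKne
    calc |setOsc T' (Kc' i) - setOsc T (Kc i)|
        = |(setOsc T' (Kc' i) - setOsc T' (Kc i)) + (setOsc T' (Kc i) - setOsc T (Kc i))| := by ring_nf
      _ ≤ |setOsc T' (Kc' i) - setOsc T' (Kc i)| + |setOsc T' (Kc i) - setOsc T (Kc i)| := abs_add_le _ _
      _ ≤ (Real.pi * ε * ρ / a + Real.pi ^ 2 * L' * ρ ^ 2 / (2 * a)) + Real.pi * K := add_le_add hsl hft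
      _ = B := by rw [hB]; ring
  have hdiff : |∑ i ∈ s, setOsc T' (Kc' i) - ∑ i ∈ s, setOsc T (Kc i)| ≤ s.card * B := by
    rw [← Finset.sum_sub_distrib]
    calc |∑ i ∈ s, (setOsc T' (Kc' i) - setOsc T (Kc i))|
        ≤ ∑ i ∈ s, |setOsc T' (Kc' i) - setOsc T (Kc i)| := Finset.abs_sum_le_sum_abs _ _
      _ ≤ ∑ i ∈ s, B := Finset.sum_le_sum hterm
      _ = s.card * B := by rw [Finset.sum_const, nsmul_eq_mul]
  rw [← mul_sub, abs_mul, abs_of_nonneg ha.le]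
  exact mul_le_mul_of_nonneg_left hdiff ha.le

/-! ### Local-to-global glue on an event-free interval -/

/-- **Local two-point bounds give a global Lipschitz bound.**  If `J ⊆ ℝ` is order-connected and every `x ∈ J` has `δ > 0` such that
`|f z − f y| ≤ K |z − y|` for all `y, z ∈ J ∩ (x − δ, x + δ)`, then `f` is `K`-Lipschitz on `J` (cover the compact `[x, y] ⊆ J` by finitely many such
windows, shrink to closed half-windows, and chain with `abs_sub_le_of_finset_closed_cover`, p733168). [folklore] -/
theorem lipschitzOnWith_of_local_two_point {f : ℝ → ℝ} {K : ℝ≥0} {J : Set ℝ} (hJ : J.OrdConnected)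
    (hloc : ∀ x ∈ J, ∃ δ > (0 : ℝ), ∀ y ∈ J, ∀ z ∈ J, |y - x| < δ → |z - x| < δ → |f z - f y| ≤ K * |z - y|) :
    LipschitzOnWith K f J := by
  classical
  -- two-point form for `x ≤ y` in `J`
  have key : ∀ x ∈ J, ∀ y ∈ J, x ≤ y → |f y - f x| ≤ (K : ℝ) * (y - x) := by
    intro x hx y hy hxy
    have hI : Icc x y ⊆ J := hJ.out hx hy
    choose! δ hδ hlip using hloc
    -- open cover of the compact `[x, y]` by the half-windows
    have hcov : Icc x y ⊆ ⋃ c ∈ Icc x y, Metric.ball c (δ c / 2) := by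
      intro z hz
      exact mem_iUnion₂.2 ⟨z, hz, Metric.mem_ball_self (half_pos (hδ z (hI hz)))⟩
    obtain ⟨t, htI, htfin, htcov⟩ := (isCompact_Icc (a := x) (b := y)).elim_finite_subcover_image
      (fun c _ => Metric.isOpen_ball) hcov
    -- closed half-windows as the finite closed cover
    let A : t → Set ℝ := fun c => Metric.closedBall (c : ℝ) (δ c / 2)
    haveI : Finite t := htfin.to_subtype
    haveI : Fintype t := Fintype.ofFinite t
    have hA : ∀ i, IsClosed (A i) := fun i => Metric.isClosed_closedBall
    have hcov' : Icc x y ⊆ ⋃ i ∈ (Finset.univ : Finset t), A i := by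
      intro z hz
      obtain ⟨c, hc, hzc⟩ := mem_iUnion₂.1 (htcov hz)
      exact mem_iUnion₂.2 ⟨⟨c, hc⟩, Finset.mem_univ _, Metric.ball_subset_closedBall hzc⟩
    have hlip' : ∀ i ∈ (Finset.univ : Finset t), ∀ u ∈ A i ∩ Icc x y, ∀ w ∈ A i ∩ Icc x y,
        |f w - f u| ≤ (K : ℝ) * |w - u| := by
      intro i _ u hu w hw
      have hcJ : (i : ℝ) ∈ J := hI (htI i.2)
      have hδi := hδ i hcJ
      have hu' : |u - i| < δ i := by
        have h := Metric.mem_closedBall.1 hu.1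
        rw [Real.dist_eq] at h
        linarith
      have hw' : |w - i| < δ i := by
        have h := Metric.mem_closedBall.1 hw.1
        rw [Real.dist_eq] at h
        linarith
      exact hlip i hcJ u (hI hu.2) w (hI hw.2) hu' hw'
    have h := abs_sub_le_of_finset_closed_cover f K A hA y _ Finset.univ x rfl hxy hcov' hlip'
    exact h
  refine LipschitzOnWith.of_dist_le_mul fun x hx y hy => ?_
  rcases le_total x y with hxy | hyx
  · have h := key x hx y hy hxy
    rw [Real.dist_eq, Real.dist_eq, abs_sub_comm, abs_of_nonpos (sub_nonpos.2 hxy)]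
    linarith
  · have h := key y hy x hx hyx
    rw [Real.dist_eq, Real.dist_eq, abs_of_nonneg (sub_nonneg.2 hyx)]
    exact h

end Summit.NavierStokesRegularity.NavierStokesRegularity.Theorems.PoloidalLiouville.CellFlux

end
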